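import Mathlib.LinearAlgebra.TensorPower.Basic
import Mathlib.LinearAlgebra.PiTensorProduct.Dual
import Mathlib.LinearAlgebra.Dual.Lemmas
import Literature.AlgebraicGeometry.Motives.MumfordTateInvariantsTensorBasis
import HarnessLib

/-!
# The contraction pairing `T^{b,a} ⊗ T^{a,b} → K` and the product `T^{a,b} ⊗ T^{c,d} ≃ T^{a+c,b+d}`

Multilinear algebra on the tensor spaces `T^{a,b}_K W = W^{⊗a} ⊗ (W^∨)^{⊗b}`
(`hodgeTensorSpaceOver K W a b`, Deligne, *Hodge cycles on abelian varieties*, LNM 900, I §3.1)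
over an arbitrary field `K`:

* `tensorSpaceMulEquiv a b c d : T^{a,b} ⊗ T^{c,d} ≃ₗ[K] T^{a+c,b+d}`, concatenation of pure
  tensors (`tensorSpaceMulEquiv_tmul`), equivariant for `GL(W)`
  (`tensorSpaceMulEquiv_map_tensorSpaceActOver`) and compatible with extension of scalars
  `ℚ → K` along the comparison maps `ι` (`tensorSpaceMulEquiv_tensorSpaceToBaseChange`);
* `tensorPairing a b : T^{b,a} →ₗ[K] Dual (T^{a,b})`, the contraction pairing
  `⟨(⊗ wₗ) ⊗ (⊗ ψₖ), (⊗ vₖ) ⊗ (⊗ φₗ)⟩ = ∏ₖ ψₖ(vₖ) · ∏ₗ φₗ(wₗ)` (`tensorPairing_tmul_tprod`),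
  `GL(W)`-invariant (`tensorPairing_tensorSpaceActOver`), perfect for `W` finite-dimensional
  (it maps the tensor basis to the dual tensor basis: `tensorPairing_hodgeTensorBasis_swap`,
  `tensorPairing_bijective`, `eq_of_forall_tensorPairing_eq`), and compatible with extension of
  scalars (`tensorPairing_tensorSpaceToBaseChange`).

These identify `(T^{a,b})^∨` with `T^{b,a}` and `End(T^{a,b}) ≅ T^{a,b} ⊗ (T^{a,b})^∨` with a
subspace of tensors, equivariantly — the device by which statements about Mumford–Tate invariant
TENSORS (the definition of `MT(H)(K)`) are turned into statements about invariant linear forms and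
equivariant endomorphisms (Deligne, LNM 900, I, proof of Prop. 3.1(c)).

## References

* P. Deligne, *Hodge cycles on abelian varieties* (notes by J. S. Milne), LNM 900 (1982), I §3.1
  and proof of Prop. 3.1.
-/

noncomputable section

open scoped TensorProduct PiTensorProduct

namespace Literature.AlgebraicGeometry.Motives

universe u v w

/-- Applying a function to a concatenated tuple concatenates the images. [folklore] -/
theorem append_comp_apply {α : Type u} {β : Type v} (f : α → β) {a c : ℕ} (v : Fin a → α)
    (w : Fin c → α) :
    (Fin.append (fun i => f (v i)) fun i => f (w i)) = fun i => f (Fin.append v w i) := by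
  funext i
  refine Fin.addCases (fun j => ?_) (fun j => ?_) i
  · simp [Fin.append_left]
  · simp [Fin.append_right]

section Generic

variable {K : Type u} [Field K] {W : Type v} [AddCommGroup W] [Module K W]

/-- Precomposition distributes over concatenated tuples of linear forms. [folklore] -/
theorem append_comp_linearMap {a c : ℕ} (φ : Fin a → Module.Dual K W) (ψ : Fin c → Module.Dual K W)
    (f : W →ₗ[K] W) :
    (Fin.append (fun i => φ i ∘ₗ f) fun i => ψ i ∘ₗ f) = fun i => Fin.append φ ψ i ∘ₗ f :=
  append_comp_apply (fun θ : Module.Dual K W => θ ∘ₗ f) φ ψ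

/-! ### The product `T^{a,b} ⊗ T^{c,d} ≃ T^{a+c,b+d}` -/

/-- **Concatenation of tensors** `T^{a,b} ⊗ T^{c,d} ≃ₗ[K] T^{a+c,b+d}`:
`((⊗v) ⊗ (⊗φ)) ⊗ ((⊗w) ⊗ (⊗ψ)) ↦ (⊗ (v ++ w)) ⊗ (⊗ (φ ++ ψ))` (Mathlib's
`tensorTensorTensorComm` followed by `TensorPower.mulEquiv` on both factors). [folklore] -/
def tensorSpaceMulEquiv (a b c d : ℕ) :
    hodgeTensorSpaceOver K W a b ⊗[K] hodgeTensorSpaceOver K W c d ≃ₗ[K]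
      hodgeTensorSpaceOver K W (a + c) (b + d) :=
  (TensorProduct.tensorTensorTensorComm K _ _ _ _).trans
    (TensorProduct.congr TensorPower.mulEquiv TensorPower.mulEquiv)

/-- `TensorPower.mulEquiv` concatenates pure tensors. [folklore] -/
theorem mulEquiv_tprod_tmul_tprod {M : Type w} [AddCommGroup M] [Module K M] {n m : ℕ}
    (x : Fin n → M) (y : Fin m → M) :
    TensorPower.mulEquiv (PiTensorProduct.tprod K x ⊗ₜ[K] PiTensorProduct.tprod K y) =
      PiTensorProduct.tprod K (Fin.append x y) := by
  rw [← TensorPower.gMul_def, TensorPower.tprod_mul_tprod]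

/-- The concatenation equivalence on pure tensors. [folklore] -/
@[simp]
theorem tensorSpaceMulEquiv_tmul {a b c d : ℕ} (v : Fin a → W) (φ : Fin b → Module.Dual K W)
    (w : Fin c → W) (ψ : Fin d → Module.Dual K W) :
    tensorSpaceMulEquiv a b c d
        ((PiTensorProduct.tprod K v ⊗ₜ[K] PiTensorProduct.tprod K φ) ⊗ₜ[K]
          (PiTensorProduct.tprod K w ⊗ₜ[K] PiTensorProduct.tprod K ψ)) =
      PiTensorProduct.tprod K (Fin.append v w) ⊗ₜ[K] PiTensorProduct.tprod K (Fin.append φ ψ) := by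
  simp [tensorSpaceMulEquiv, TensorProduct.tensorTensorTensorComm_tmul, mulEquiv_tprod_tmul_tprod]

/-- **Equivariance of concatenation**: `m ((g · x) ⊗ (g · y)) = g · m (x ⊗ y)` for `g ∈ GL(W)`.
[folklore] -/
theorem tensorSpaceMulEquiv_map_tensorSpaceActOver {a b c d : ℕ} (g : W ≃ₗ[K] W)
    (z : hodgeTensorSpaceOver K W a b ⊗[K] hodgeTensorSpaceOver K W c d) :
    tensorSpaceMulEquiv a b c d
        (TensorProduct.map (tensorSpaceActOver (a := a) (b := b) g).toLinearMap
          (tensorSpaceActOver (a := c) (b := d) g).toLinearMap z) =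
      tensorSpaceActOver g (tensorSpaceMulEquiv a b c d z) := by
  suffices h : (tensorSpaceMulEquiv (K := K) (W := W) a b c d).toLinearMap ∘ₗ
      TensorProduct.map (tensorSpaceActOver (a := a) (b := b) g).toLinearMap
        (tensorSpaceActOver (a := c) (b := d) g).toLinearMap =
      (tensorSpaceActOver (a := a + c) (b := b + d) g).toLinearMap ∘ₗ
        (tensorSpaceMulEquiv a b c d).toLinearMap from
    LinearMap.congr_fun h z
  ext v φ w ψ
  simp [append_comp_apply, append_comp_linearMap]

/-- The same for the inverse: `m⁻¹ (g · t) = (g ⊗ g) · m⁻¹ t`. [folklore] -/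
theorem tensorSpaceMulEquiv_symm_tensorSpaceActOver {a b c d : ℕ} (g : W ≃ₗ[K] W)
    (t : hodgeTensorSpaceOver K W (a + c) (b + d)) :
    (tensorSpaceMulEquiv a b c d).symm (tensorSpaceActOver g t) =
      TensorProduct.map (tensorSpaceActOver (a := a) (b := b) g).toLinearMap
        (tensorSpaceActOver (a := c) (b := d) g).toLinearMap ((tensorSpaceMulEquiv a b c d).symm t) := by
  apply (tensorSpaceMulEquiv (K := K) (W := W) a b c d).injective
  rw [LinearEquiv.apply_symm_apply, tensorSpaceMulEquiv_map_tensorSpaceActOver,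
    LinearEquiv.apply_symm_apply]

/-! ### The contraction pairing `T^{b,a} → (T^{a,b})^∨` -/

/-- **The contraction pairing** `T^{b,a} →ₗ[K] (T^{a,b})^∨`: the `W`-slots of one space are
paired with the `W^∨`-slots of the other (Mathlib's `PiTensorProduct.dualDistrib`,
`TensorProduct.dualDistrib`, `Module.Dual.eval`). [folklore] -/
def tensorPairing (a b : ℕ) :
    hodgeTensorSpaceOver K W b a →ₗ[K] Module.Dual K (hodgeTensorSpaceOver K W a b) :=
  TensorProduct.dualDistrib K (⨂[K]^a W) (⨂[K]^b (Module.Dual K W)) ∘ₗ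
    TensorProduct.map (PiTensorProduct.dualDistrib (M := fun _ : Fin a => W))
      (PiTensorProduct.dualDistrib (M := fun _ : Fin b => Module.Dual K W) ∘ₗ
        PiTensorProduct.map fun _ => Module.Dual.eval K W) ∘ₗ
    (TensorProduct.comm K (⨂[K]^b W) (⨂[K]^a (Module.Dual K W))).toLinearMap

/-- The contraction pairing on pure tensors:
`⟨(⊗ wₗ) ⊗ (⊗ ψₖ), (⊗ vₖ) ⊗ (⊗ φₗ)⟩ = ∏ₖ ψₖ(vₖ) · ∏ₗ φₗ(wₗ)`. [folklore] -/
@[simp]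
theorem tensorPairing_tmul_tprod {a b : ℕ} (w : Fin b → W) (ψ : Fin a → Module.Dual K W)
    (v : Fin a → W) (φ : Fin b → Module.Dual K W) :
    tensorPairing a b (PiTensorProduct.tprod K w ⊗ₜ[K] PiTensorProduct.tprod K ψ)
        (PiTensorProduct.tprod K v ⊗ₜ[K] PiTensorProduct.tprod K φ) =
      (∏ k, ψ k (v k)) * ∏ l, φ l (w l) := by
  simp [tensorPairing, PiTensorProduct.dualDistrib_apply, TensorProduct.dualDistrib_apply,
    PiTensorProduct.map_tprod]

/-- **Invariance of the contraction pairing**: `⟨g · y, g · x⟩ = ⟨y, x⟩` for `g ∈ GL(W)`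
(`(φ ∘ g⁻¹)(g v) = φ v`). [folklore] -/
theorem tensorPairing_tensorSpaceActOver {a b : ℕ} (g : W ≃ₗ[K] W)
    (y : hodgeTensorSpaceOver K W b a) (x : hodgeTensorSpaceOver K W a b) :
    tensorPairing a b (tensorSpaceActOver g y) (tensorSpaceActOver g x) = tensorPairing a b y x := by
  suffices h : (tensorPairing (K := K) (W := W) a b ∘ₗ
      (tensorSpaceActOver (a := b) (b := a) g).toLinearMap).compl₂
        (tensorSpaceActOver (a := a) (b := b) g).toLinearMap = tensorPairing a b from
    LinearMap.congr_fun₂ h y x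
  ext w ψ v φ
  simp

/-- Invariance, one-sided form: `⟨y, g · x⟩ = ⟨g⁻¹ · y, x⟩`. [folklore] -/
theorem tensorPairing_apply_tensorSpaceActOver {a b : ℕ} (g : W ≃ₗ[K] W)
    (y : hodgeTensorSpaceOver K W b a) (x : hodgeTensorSpaceOver K W a b) :
    tensorPairing a b y (tensorSpaceActOver g x) = tensorPairing a b (tensorSpaceActOver g⁻¹ y) x := by
  conv_lhs => rw [← show tensorSpaceActOver (a := b) (b := a) g (tensorSpaceActOver g⁻¹ y) = y by
    rw [← tensorSpaceActOver_mul_apply, mul_inv_cancel, tensorSpaceActOver_one]; rfl]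
  exact tensorPairing_tensorSpaceActOver g _ x

section Basis

variable {S : Type w} [Fintype S] [DecidableEq S] (e : Module.Basis S K W)

/-- The contraction pairing on tensor basis vectors: `⟨E'_{(β',γ')}, E_{(β,γ)}⟩ = [γ' = β] [β' = γ]`.
[folklore] -/
theorem tensorPairing_hodgeTensorBasis {a b : ℕ} (y : (Fin b → S) × (Fin a → S))
    (x : (Fin a → S) × (Fin b → S)) :
    tensorPairing a b (hodgeTensorBasis e b a y) (hodgeTensorBasis e a b x) =
      if y = (x.2, x.1) then 1 else 0 := by
  obtain ⟨β', γ'⟩ := y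
  obtain ⟨β, γ⟩ := x
  rw [hodgeTensorBasis_apply, hodgeTensorBasis_apply, tensorPairing_tmul_tprod]
  simp only [Module.Basis.dualBasis_apply_self, Finset.prod_boole, Finset.mem_univ, true_implies,
    Prod.mk.injEq]
  by_cases h₁ : γ' = β
  · subst h₁
    by_cases h₂ : β' = γ
    · subst h₂
      simp
    · have h₂' : ¬ ∀ l, β' l = γ l := fun h => h₂ (funext h)
      simp [h₂, h₂']
  · have h₁' : ¬ ∀ k, β k = γ' k := fun h => h₁ (funext fun k => (h k).symm)
    simp [h₁, h₁']

/-- **The contraction pairing maps the tensor basis to the dual tensor basis**: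
`⟨E'_{(γ,β)}, ·⟩` is the coordinate function of `E_{(β,γ)}`. [folklore] -/
theorem tensorPairing_hodgeTensorBasis_swap {a b : ℕ} (x : (Fin a → S) × (Fin b → S)) :
    tensorPairing a b (hodgeTensorBasis e b a (x.2, x.1)) = (hodgeTensorBasis e a b).coord x := by
  refine (hodgeTensorBasis e a b).ext fun x' => ?_
  rw [tensorPairing_hodgeTensorBasis, Module.Basis.coord_apply, Module.Basis.repr_self,
    Finsupp.single_apply]
  obtain ⟨β, γ⟩ := x
  obtain ⟨β', γ'⟩ := x'
  by_cases hβ : β = β'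
  · subst hβ
    by_cases hγ : γ = γ'
    · subst hγ
      simp
    · have hγ' : ¬ γ' = γ := fun h => hγ h.symm
      simp [hγ, hγ']
  · have hβ' : ¬ β' = β := fun h => hβ h.symm
    simp [hβ, hβ']

/-- As a linear map, the contraction pairing is the basis isomorphism from the (re-indexed)
tensor basis of `T^{b,a}` to the dual basis of the tensor basis of `T^{a,b}`. [folklore] -/
theorem tensorPairing_eq_equiv (a b : ℕ) :
    tensorPairing (K := K) (W := W) a b =
      (((hodgeTensorBasis e b a).reindex (Equiv.prodComm _ _)).equiv
        (hodgeTensorBasis e a b).dualBasis (Equiv.refl _)).toLinearMap := by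
  refine ((hodgeTensorBasis e b a).reindex (Equiv.prodComm _ _)).ext fun x => ?_
  rw [LinearEquiv.coe_coe, Module.Basis.equiv_apply, Equiv.refl_apply, Module.Basis.reindex_apply,
    Equiv.prodComm_symm, Equiv.prodComm_apply, Module.Basis.coe_dualBasis]
  exact tensorPairing_hodgeTensorBasis_swap e x

end Basis

section FiniteDimensional

variable [FiniteDimensional K W]

/-- **The contraction pairing is perfect** (`W` finite-dimensional): `T^{b,a} ≃ (T^{a,b})^∨`.
[folklore] -/
theorem tensorPairing_bijective (a b : ℕ) :
    Function.Bijective (tensorPairing (K := K) (W := W) a b) := by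
  rw [tensorPairing_eq_equiv (Module.finBasis K W) a b]
  exact LinearEquiv.bijective _

/-- Every linear form on `T^{a,b}` is the contraction against a unique tensor in `T^{b,a}`.
[folklore] -/
theorem exists_tensorPairing_eq {a b : ℕ} (lam : Module.Dual K (hodgeTensorSpaceOver K W a b)) :
    ∃ y : hodgeTensorSpaceOver K W b a, tensorPairing a b y = lam :=
  (tensorPairing_bijective a b).2 lam

/-- **Non-degeneracy**: a tensor is determined by its contractions against all of `T^{b,a}`.
[folklore] -/
theorem eq_of_forall_tensorPairing_eq {a b : ℕ} {x x' : hodgeTensorSpaceOver K W a b}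
    (h : ∀ y, tensorPairing a b y x = tensorPairing a b y x') : x = x' := by
  have h' : ∀ lam : Module.Dual K (hodgeTensorSpaceOver K W a b), lam (x - x') = 0 := by
    intro lam
    obtain ⟨y, rfl⟩ := exists_tensorPairing_eq lam
    rw [map_sub, h y, sub_self]
  exact sub_eq_zero.1 ((Module.forall_dual_apply_eq_zero_iff K (x - x')).1 h')

/-- Two linear maps into `T^{a,b}` agreeing after every contraction are equal. [folklore] -/
theorem linearMap_ext_of_tensorPairing {a b : ℕ} {M : Type w} [AddCommMonoid M] [Module K M]
    {f g : M →ₗ[K] hodgeTensorSpaceOver K W a b}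
    (h : ∀ y m, tensorPairing a b y (f m) = tensorPairing a b y (g m)) : f = g :=
  LinearMap.ext fun m => eq_of_forall_tensorPairing_eq fun y => h y m

end FiniteDimensional

end Generic

/-! ### Compatibility with extension of scalars `ℚ → K` -/

section BaseChange

variable (K : Type u) [Field K] [Algebra ℚ K] (V : Type v) [AddCommGroup V] [Module ℚ V]

/-- The comparison maps on two tensor spaces combined: `x ⊗ y ↦ ι x ⊗ ι y`
(`ℚ`-linear, into the tensor product over `K`). [folklore] -/
def tensorSpaceToBaseChange₂ (a b c d : ℕ) :
    hodgeTensorSpace V a b ⊗[ℚ] hodgeTensorSpace V c d →ₗ[ℚ]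
      hodgeTensorSpaceOver K (K ⊗[ℚ] V) a b ⊗[K] hodgeTensorSpaceOver K (K ⊗[ℚ] V) c d :=
  TensorProduct.mapOfCompatibleSMul K ℚ ℚ _ _ ∘ₗ
    TensorProduct.map (tensorSpaceToBaseChange K V a b) (tensorSpaceToBaseChange K V c d)

/-- `tensorSpaceToBaseChange₂` on `x ⊗ y`. [folklore] -/
@[simp]
theorem tensorSpaceToBaseChange₂_tmul {a b c d : ℕ} (x : hodgeTensorSpace V a b)
    (y : hodgeTensorSpace V c d) :
    tensorSpaceToBaseChange₂ K V a b c d (x ⊗ₜ[ℚ] y) =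
      tensorSpaceToBaseChange K V a b x ⊗ₜ[K] tensorSpaceToBaseChange K V c d y := by
  simp [tensorSpaceToBaseChange₂]

/-- **Concatenation commutes with extension of scalars**: `m_K (ι x ⊗ ι y) = ι (m (x ⊗ y))`.
[folklore] -/
theorem tensorSpaceMulEquiv_tensorSpaceToBaseChange {a b c d : ℕ} (x : hodgeTensorSpace V a b)
    (y : hodgeTensorSpace V c d) :
    tensorSpaceMulEquiv a b c d (tensorSpaceToBaseChange K V a b x ⊗ₜ[K] tensorSpaceToBaseChange K V c d y) =
      tensorSpaceToBaseChange K V (a + c) (b + d) (tensorSpaceMulEquiv a b c d (x ⊗ₜ[ℚ] y)) := by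
  suffices h : ((tensorSpaceMulEquiv (K := K) (W := K ⊗[ℚ] V) a b c d).toLinearMap.restrictScalars ℚ) ∘ₗ
      tensorSpaceToBaseChange₂ K V a b c d =
      tensorSpaceToBaseChange K V (a + c) (b + d) ∘ₗ
        (tensorSpaceMulEquiv (K := ℚ) (W := V) a b c d).toLinearMap from
    by simpa using LinearMap.congr_fun h (x ⊗ₜ[ℚ] y)
  ext v φ w ψ
  simp [append_comp_apply]

/-- **The contraction pairing commutes with extension of scalars**:
`⟨ι y, ι x⟩_K = ⟨y, x⟩_ℚ` in `K`. [folklore] -/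
theorem tensorPairing_tensorSpaceToBaseChange {a b : ℕ} (y : hodgeTensorSpace V b a)
    (x : hodgeTensorSpace V a b) :
    tensorPairing a b (tensorSpaceToBaseChange K V b a y) (tensorSpaceToBaseChange K V a b x) =
      algebraMap ℚ K (tensorPairing a b y x) := by
  -- both sides are `ℚ`-bilinear in `(y, x)`; compare them on pure tensors
  let B₁ : hodgeTensorSpace V b a →ₗ[ℚ] hodgeTensorSpace V a b →ₗ[ℚ] K :=
    LinearMap.mk₂ ℚ
      (fun y x => tensorPairing a b (tensorSpaceToBaseChange K V b a y)
        (tensorSpaceToBaseChange K V a b x))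
      (fun y₁ y₂ x => by simp only [map_add, LinearMap.add_apply])
      (fun c y x => by simp only [LinearMap.map_smul_of_tower, LinearMap.smul_apply])
      (fun y x₁ x₂ => by simp only [map_add])
      (fun c y x => by simp only [LinearMap.map_smul_of_tower])
  let B₂ : hodgeTensorSpace V b a →ₗ[ℚ] hodgeTensorSpace V a b →ₗ[ℚ] K :=
    (tensorPairing (K := ℚ) (W := V) a b).compr₂ (Algebra.linearMap ℚ K)
  suffices h : B₁ = B₂ from LinearMap.congr_fun₂ h y x
  ext w ψ v φ
  simp [B₁, B₂, Module.Dual.baseChange_apply_tmul, Algebra.smul_def, map_mul, map_prod]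

end BaseChange

end Literature.AlgebraicGeometry.Motives

end
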